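import Summits.QuantumFields.YangMills.Theorems.BalabanUVNodesN15KingModelBlockFieldNormalisationDensity
import Summits.QuantumFields.YangMills.Theorems.BalabanUVNodesN15KingModelTwoPointThermodynamicLimit
import Mathlib.Analysis.Normed.Group.FunctionSeries
import Mathlib.Analysis.SpecialFunctions.Trigonometric.Sinc
import HarnessLib

/-!
# BalabanUVNodes ∕ N15 — THE KING-MODEL RUNG (PART Ε-u): KING's CONTINUUM SYMBOL `Δ^{(∞)}(p′)` IS CONTINUOUS ON THE ZONE — the continuum form factor is `|f₀(x)| = |sinc(x∕2)|`,
# the alias series `S_∞` converges UNIFORMLY near the zone (Weierstrass), hence `|Ω|⁻¹ln det Δ^{(∞)} → (2π)^{−(d+1)}∫_{BZ} ln Δ^{(∞)}(p′)dp′` in infinite volume and THE DOUBLE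
# LIMIT: `bzMean(ln Δ^{(K)}) → bzMean(ln Δ^{(∞)})` with King's rate `η² = L^{−2K}` (part Ε-t's `f_∞` identified)
# (Track A, DAG node N15 = NE2; FAN-OUT v1.1 §N15 s3 «KING-MODEL RUNG»; parts Ϡ-b∕Ϡ-c (the series) + Ε-o∕Ε-r∕Ε-t; count-neutral)

HONEST FRAMING.  Count-neutral (cell `pub-ymgap`, seat `pub-ymgap-dag-n15-e` g40; `--supports stmt-QuantumFields-27366 --as helper` = K3⁸).
TEMPLATE LITERATURE: C. King, Commun. Math. Phys. **102** (1986) 649–677 [King1986], (4.3)–(4.5) p.670 (the form factor `u`, the symbol `Δ^{(k)}(p′)`), (4.20)–(4.22) p.672 (the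
alias majorants), (3.89) p.668 ∕ (3.93) p.669 (normalisations per site), Thm 3.4 (3.9) p.656 (the two-model comparison as `k → ∞`).  Part Ϡ-b typed the continuum alias series
`S_∞(p′) = Σ_{j∈ℤ^{d+1}} |u⁰(p′+2πj)|²∕(|p′+2πj|² + m²)` (`aliasSeries0`, summable on the zone by the p′-DEPENDENT majorant `aliasMajorant`); part Ϡ-c the symbol `Δ^{(∞)}(p′) =
a_∞∕(1 + a_∞S_∞(p′))` (`effSymLim`); part Ε-t left the identification of the `K → ∞` limit of the infinite-volume densities open for want of continuity of `S_∞`.  THIS FILE: §1 ★ `continuous_aliasTerm0` (each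
alias term is continuous on all of momentum space; `‖f₀(x)‖² = sinc(x∕2)²` is part Ϝ-j's `norm_sq_uFac0_eq_sinc_sq`); §2 a p′-UNIFORM majorant on the sup-ball of radius `3π∕2` ⊃ zone: `norm_uFac0_sq_le_of_ne_zero` (`‖f₀(y)‖² ≤ 4∕y²`),
`aliasTerm0_le_unifMajorant` (`≤ m⁻²(64∕π)^{d+1}·Π_μ aliasMaj 2 0 (j_μ)`, summable by Ϡ-b's `summable_prod_aliasMaj` at `p′ = 0`), ★★ **`continuousOn_aliasSeries0`** (Weierstrass
M-test, `continuousOn_tsum`), ★★ **`continuousAt_aliasSeries0`** ∕ ★★★ **`continuousAt_effSymLim`** ∕ `continuousAt_log_effSymLim` at every point of the closed zone; §3 ★★★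
**`tendsto_log_det_effLaplacianLim_div_card`** (`|Ω_k|⁻¹ln det Δ^{(∞)}_{Ω_k} → bzMean(ln Δ^{(∞)})`, part Ε-o's determinant + part Ε-r's engine), ★★★
**`abs_bzMean_log_DeltaEff_sub_lim_le`** (`|bzMean(ln Δ^{(K)}) − bzMean(ln Δ^{(∞)})| ≤ C′·L^{−2K}`, part Ε-o's volume-uniform rate passed to infinite volume), ★★★
**`tendsto_bzMean_log_DeltaEff`** (THE DOUBLE LIMIT), `tendsto_log_gaussNorm_effLaplacianLim_div_card` (`|Ω_k|⁻¹ln N_∞ → ½ln 2π − ½bzMean(ln Δ^{(∞)})`).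

PRIOR TREE ART (used, not restated): part Ϡ-a∕b (`uFac0`, `norm_uFac0_le`, `uWeight0`, `norm_uWeight0`, `aliasTerm0`, `aliasTerm0_nonneg`, `aliasSeries0`, `summable_prod_aliasMaj`),
part Ϝ-j `…TwoPointThermodynamicLimit` (`norm_sq_uFac0_eq_sinc_sq`, `continuous_norm_sq_uWeight0`, `sinc_sq_half_le_four_div_sq`), `King1986.AliasSums` (`aliasPt`, `aliasMaj`, `aliasMaj_nonneg`, `momSq`, `momSq_nonneg`), part Ϡ-c (`effSymLim`, `effSymLim_pos`, `aInf`, `aInf_pos`), part Ε-o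
(`log_det_effLaplacianLim`, `abs_log_det_div_card_sub_lim_le`), part Ε-p (`log_gaussNorm_effLaplacianLim`), part Ε-r (`bzMean`), part Ε-t (`tendsto_sum_symbol_sOf_div_card_of_continuousAt`,
`tendsto_log_det_effLaplacian_div_card`), Mathlib (`Real.sinc`, `continuousOn_tsum`, `pi_norm_lt_iff`).  NOT Bałaban's covariant objects; NOT a node discharge (N15 is booked through
n15-a's knit, untouched); nothing continuum-YM ∕ `ℝ⁴` ∕ OS ∕ Clay.  0 `sorry`, 0 `def`.

HONEST SCOPE.  King's `A = 0` free model in momentum variables (dimension written `d+1` in §3, any `dd` in §1–§2); `m² > 0`, `a > 0`, `L` odd `≥ 2`.  Locators: [King1986] (4.3)–(4.5)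
p.670, (4.20)–(4.22) p.672, (3.89) p.668, (3.93) p.669, Thm 3.4 (3.9) p.656.
-/

noncomputable section

open scoped BigOperators Topology
open Finset Filter

namespace Summit.QuantumFields.YangMills.BalabanUVNodes.N15KingModelRung.TorusSpectral

open Literature.MathematicalPhysics.QuantumFieldTheory.Balaban1983to89.B5Prop11Plancherel (Tor sOf)
open Literature.MathematicalPhysics.QuantumFieldTheory.King1986 (aK aK_pos DeltaEff aliasPt aliasMaj aliasMaj_nonneg momSq momSq_nonneg)
open Literature.MathematicalPhysics.QuantumFieldTheory.King1986.Torus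
open Summit.QuantumFields.YangMills.BalabanUVNodes.N15KingModelRung.FreeField (gaussNorm)

/-! ## §1 The continuum form factor through `sinc`; continuity of each alias term -/

section Terms

variable {dd : ℕ}

/- `‖f₀(x)‖² = sinc(x∕2)²` and the continuity of `p ↦ |u⁰(p)|²` are part Ϝ-j's `norm_sq_uFac0_eq_sinc_sq` ∕ `continuous_norm_sq_uWeight0` (reused, not restated). -/

/-- ★ each continuum alias term `p′ ↦ |u⁰(p′+2πj)|²∕(|p′+2πj|² + m²)` is continuous on all of momentum space (`m² > 0`). [cite: King1986, (4.5) p.670] -/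
theorem continuous_aliasTerm0 {M : ℝ} (hM : 0 < M) (j : Fin dd → ℤ) : Continuous fun p : Fin dd → ℝ => aliasTerm0 M p j := by
  have hpt : Continuous fun p : Fin dd → ℝ => aliasPt p j := continuous_pi fun μ => ((continuous_apply μ).add continuous_const)
  have hden : Continuous fun p : Fin dd → ℝ => momSq (aliasPt p j) + M := by
    refine Continuous.add ?_ continuous_const
    unfold Literature.MathematicalPhysics.QuantumFieldTheory.King1986.momSq
    exact continuous_finsetSum _ fun μ _ => ((continuous_apply μ).comp hpt).pow 2
  unfold aliasTerm0
  exact (continuous_norm_sq_uWeight0.comp hpt).div hden fun p => (by have := momSq_nonneg (aliasPt p j); positivity)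

end Terms

/-! ## §2 A uniform majorant near the zone; continuity of `S_∞` and `Δ^{(∞)}` -/

section Series

variable {dd : ℕ}

/-- `‖f₀(y)‖² ≤ 4∕y²` for `y ≠ 0` (`|sin| ≤ 1`). [cite: King1986, (4.20) p.672] -/
theorem norm_uFac0_sq_le_of_ne_zero {y : ℝ} (hy : y ≠ 0) : ‖uFac0 y‖ ^ 2 ≤ 4 / y ^ 2 := by
  rw [norm_sq_uFac0_eq_sinc_sq]
  exact sinc_sq_half_le_four_div_sq hy

/-- one coordinate of the uniform majorant: for `|x| ≤ 3π∕2` and every `i ∈ ℤ`, `‖f₀(x + 2πi)‖² ≤ (64∕π)·aliasMaj 2 0 i`. [cite: King1986, (4.20)–(4.22) p.672] -/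
theorem norm_uFac0_sq_alias_le {x : ℝ} (hx : |x| ≤ 3 * Real.pi / 2) (i : ℤ) : ‖uFac0 (x + 2 * Real.pi * i)‖ ^ 2 ≤ 64 / Real.pi * aliasMaj 2 0 i := by
  have hπ := Real.pi_pos
  have hπ3 := Real.pi_gt_three
  have hπ4 := Real.pi_lt_four
  unfold Literature.MathematicalPhysics.QuantumFieldTheory.King1986.aliasMaj
  rcases eq_or_ne i 0 with rfl | hi
  · rw [if_pos rfl, mul_one]
    have h1 : ‖uFac0 (x + 2 * Real.pi * ((0 : ℤ) : ℝ))‖ ^ 2 ≤ 1 := by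
      rw [sq_le_one_iff_abs_le_one, abs_of_nonneg (norm_nonneg _)]; exact norm_uFac0_le _
    have h2 : (1 : ℝ) ≤ 64 / Real.pi := by rw [le_div_iff₀ hπ]; linarith
    exact h1.trans h2
  · rw [if_neg hi, zero_add]
    have hi1 : (1 : ℝ) ≤ |(i : ℝ)| := by rw [← Int.cast_abs]; exact_mod_cast Int.one_le_abs hi
    -- `|x + 2πi| ≥ π|i|∕2`
    have hy : Real.pi * |(i : ℝ)| / 2 ≤ |x + 2 * Real.pi * i| := by
      have h1 : |2 * Real.pi * (i : ℝ)| - |x| ≤ |x + 2 * Real.pi * i| := by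
        have := abs_sub_abs_le_abs_sub (2 * Real.pi * (i : ℝ)) (-x)
        rw [abs_neg, sub_neg_eq_add, add_comm] at this
        exact this
      rw [abs_mul, abs_of_pos (by positivity : (0 : ℝ) < 2 * Real.pi)] at h1
      nlinarith
    have hy0 : x + 2 * Real.pi * i ≠ 0 := by
      intro h; rw [h, abs_zero] at hy; nlinarith
    have hypos : 0 < |x + 2 * Real.pi * (i : ℝ)| := abs_pos.mpr hy0
    calc ‖uFac0 (x + 2 * Real.pi * i)‖ ^ 2 ≤ 4 / (x + 2 * Real.pi * i) ^ 2 := norm_uFac0_sq_le_of_ne_zero hy0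
      _ ≤ 4 / (Real.pi * |(i : ℝ)| / 2) ^ 2 := by
          rw [← sq_abs (x + _)]
          exact div_le_div_of_nonneg_left (by norm_num) (by positivity) (pow_le_pow_left₀ (by positivity) hy 2)
      _ = 64 / Real.pi * (Real.pi * |2 * Real.pi * (i : ℝ)| ^ (-(2 : ℝ))) := by
          rw [Real.rpow_neg (abs_nonneg _), Real.rpow_two, abs_mul, abs_of_pos (by positivity : (0 : ℝ) < 2 * Real.pi)]
          field_simp
          ring

/-- ★ **A `p′`-UNIFORM SUMMABLE MAJORANT NEAR THE ZONE**: for `‖p′‖_∞ ≤ 3π∕2` and every `j ∈ ℤ^{d}`, `aliasTerm0 m² p′ j ≤ m⁻²(64∕π)^{d}·Π_μ aliasMaj 2 0 (j_μ)`.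
[cite: King1986, (4.20)–(4.22) p.672] -/
theorem aliasTerm0_le_unifMajorant {M : ℝ} (hM : 0 < M) {p : Fin dd → ℝ} (hp : ∀ μ, |p μ| ≤ 3 * Real.pi / 2) (j : Fin dd → ℤ) :
    aliasTerm0 M p j ≤ M⁻¹ * (64 / Real.pi) ^ dd * ∏ μ, aliasMaj 2 0 (j μ) := by
  unfold aliasTerm0
  have hnum : ‖uWeight0 (aliasPt p j)‖ ^ 2 ≤ (64 / Real.pi) ^ dd * ∏ μ, aliasMaj 2 0 (j μ) := by
    rw [norm_uWeight0, ← Finset.prod_pow,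
      show (64 / Real.pi) ^ dd * ∏ μ, aliasMaj 2 0 (j μ) = ∏ μ : Fin dd, (64 / Real.pi * aliasMaj 2 0 (j μ)) by
        rw [Finset.prod_mul_distrib, Finset.prod_const, Finset.card_univ, Fintype.card_fin]]
    refine Finset.prod_le_prod (fun μ _ => sq_nonneg _) fun μ _ => ?_
    exact norm_uFac0_sq_alias_le (hp μ) (j μ)
  have hden : M ≤ momSq (aliasPt p j) + M := by linarith [momSq_nonneg (aliasPt p j)]
  have hP : 0 ≤ (64 / Real.pi) ^ dd * ∏ μ, aliasMaj 2 0 (j μ) := mul_nonneg (by positivity) (Finset.prod_nonneg fun μ _ => aliasMaj_nonneg _ _ _)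
  calc ‖uWeight0 (aliasPt p j)‖ ^ 2 / (momSq (aliasPt p j) + M) ≤ ((64 / Real.pi) ^ dd * ∏ μ, aliasMaj 2 0 (j μ)) / M := by gcongr
    _ = M⁻¹ * (64 / Real.pi) ^ dd * ∏ μ, aliasMaj 2 0 (j μ) := by rw [div_eq_inv_mul, mul_assoc]

/-- the uniform majorant is summable over `ℤ^{d}` (part Ϡ-b's `summable_prod_aliasMaj` at `p′ = 0`). [cite: King1986, (4.22) p.672] -/
theorem summable_unifMajorant (M : ℝ) : Summable fun j : Fin dd → ℤ => M⁻¹ * (64 / Real.pi) ^ dd * ∏ μ, aliasMaj 2 0 (j μ) := by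
  have h := summable_prod_aliasMaj (d := dd) (p := fun _ => 0) (fun μ => by rw [abs_zero]; exact Real.pi_pos.le)
  exact (h.mul_left (M⁻¹ * (64 / Real.pi) ^ dd)).congr fun j => by ring

/-- ★★ **THE CONTINUUM ALIAS SERIES IS CONTINUOUS NEAR THE ZONE** (Weierstrass M-test on the open sup-ball of radius `3π∕2`). [cite: King1986, (4.5) p.670, (4.22) p.672] -/
theorem continuousOn_aliasSeries0 {M : ℝ} (hM : 0 < M) : ContinuousOn (aliasSeries0 (d := dd) M) (Metric.ball 0 (3 * Real.pi / 2)) := by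
  have hπ := Real.pi_pos
  show ContinuousOn (fun p : Fin dd → ℝ => ∑' j : Fin dd → ℤ, aliasTerm0 M p j) (Metric.ball 0 (3 * Real.pi / 2))
  refine continuousOn_tsum (fun j => (continuous_aliasTerm0 hM j).continuousOn) (summable_unifMajorant (dd := dd) M) fun j p hp => ?_
  rw [Real.norm_eq_abs, abs_of_nonneg (aliasTerm0_nonneg hM.le p j)]
  refine aliasTerm0_le_unifMajorant hM (fun μ => ?_) j
  rw [mem_ball_zero_iff, pi_norm_lt_iff (by positivity)] at hp
  have := hp μ
  rw [Real.norm_eq_abs] at this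
  exact this.le

/-- ★★ `S_∞` is continuous at every point of the closed zone `[−π,π]^{d}`. [cite: King1986, (4.5) p.670] -/
theorem continuousAt_aliasSeries0 {M : ℝ} (hM : 0 < M) {p : Fin dd → ℝ} (hp : ∀ μ, |p μ| ≤ Real.pi) : ContinuousAt (aliasSeries0 (d := dd) M) p := by
  have hπ := Real.pi_pos
  refine (continuousOn_aliasSeries0 hM).continuousAt (Metric.isOpen_ball.mem_nhds ?_)
  rw [mem_ball_zero_iff, pi_norm_lt_iff (by positivity)]
  intro μ
  rw [Real.norm_eq_abs]
  linarith [hp μ]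

/-- ★★★ **KING's CONTINUUM SYMBOL `Δ^{(∞)}(p′) = a_∞∕(1 + a_∞S_∞(p′))` IS CONTINUOUS ON THE CLOSED ZONE** (`a > 0`, `L > 1`, `m² > 0`). [cite: King1986, (4.5) p.670, Thm 3.4 (3.9) p.656] -/
theorem continuousAt_effSymLim {a Lr M : ℝ} (ha : 0 < a) (hL : 1 < Lr) (hM : 0 < M) {p : Fin dd → ℝ} (hp : ∀ μ, |p μ| ≤ Real.pi) :
    ContinuousAt (effSymLim (d := dd) a Lr M) p := by
  show ContinuousAt (fun q : Fin dd → ℝ => aInf a Lr / (1 + aInf a Lr * aliasSeries0 M q)) p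
  have h1 := aInf_pos ha hL
  have h2 := aliasSeries0_nonneg (d := dd) hM.le p
  exact continuousAt_const.div (continuousAt_const.add (continuousAt_const.mul (continuousAt_aliasSeries0 hM hp))) (by positivity)

/-- `log Δ^{(∞)}` is continuous on the closed zone. [cite: King1986, (4.5) p.670] -/
theorem continuousAt_log_effSymLim {a Lr M : ℝ} (ha : 0 < a) (hL : 1 < Lr) (hM : 0 < M) {p : Fin dd → ℝ} (hp : ∀ μ, |p μ| ≤ Real.pi) :
    ContinuousAt (fun q : Fin dd → ℝ => Real.log (effSymLim a Lr M q)) p :=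
  (continuousAt_effSymLim ha hL hM hp).log (effSymLim_pos ha hL hM.le p).ne'

end Series

/-! ## §3 Infinite volume for `Δ^{(∞)}`; the double limit -/

section Limits

variable {d : ℕ} (L : ℕ)

/-- ★★★ **THE CONTINUUM EFFECTIVE DETERMINANT PER SITE IN INFINITE VOLUME**: along any tori with all periods `→ ∞`, `|Ω_k|⁻¹ln det Δ^{(∞)}_{Ω_k} → bzMean(ln Δ^{(∞)}) =
(2π)^{−(d+1)}∫_{(−π,π]^{d+1}} ln Δ^{(∞)}(p′)dp′` (`L` odd `≥ 2`, `a, m² > 0`). [cite: King1986, (3.89) p.668, (4.5) p.670, (4.35) p.674] -/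
theorem tendsto_log_det_effLaplacianLim_div_card (hLodd : Odd L) (hL : 2 ≤ L) {a m2 : ℝ} (ha : 0 < a) (hm : 0 < m2) (Mseq : ℕ → Fin (d + 1) → ℕ)
    (hpos : ∀ k ν, 0 < Mseq k ν) (hlim : ∀ ν, Tendsto (fun k => (Mseq k ν : ℝ)) atTop atTop) :
    Tendsto (fun k => haveI : ∀ ν, NeZero (Mseq k ν) := fun ν => ⟨(hpos k ν).ne'⟩
      (Fintype.card (Tor (Mseq k)) : ℝ)⁻¹ * Real.log (Matrix.of fun b b' => effLaplacianLim L (Mseq k) a m2 b b').det) atTop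
      (𝓝 (bzMean (fun p : Fin (d + 1) → ℝ => Real.log (effSymLim a L m2 p)) d)) := by
  have hL1 : (1 : ℝ) < L := by exact_mod_cast (show 1 < L by omega)
  refine (tendsto_sum_symbol_sOf_div_card_of_continuousAt (fun p : Fin (d + 1) → ℝ => Real.log (effSymLim a L m2 p))
    (fun p hp => continuousAt_log_effSymLim ha hL1 hm hp) Mseq hpos hlim).congr fun k => ?_
  haveI : ∀ ν, NeZero (Mseq k ν) := fun ν => ⟨(hpos k ν).ne'⟩
  rw [log_det_effLaplacianLim L (Mseq k) hLodd hL ha hm]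

/-- `|Ω_k|⁻¹ln N_∞ → ½ln 2π − ½bzMean(ln Δ^{(∞)})` in infinite volume. [cite: King1986, (3.89) p.668, (2.6) p.652] -/
theorem tendsto_log_gaussNorm_effLaplacianLim_div_card (hLodd : Odd L) (hL : 2 ≤ L) {a m2 : ℝ} (ha : 0 < a) (hm : 0 < m2) (Mseq : ℕ → Fin (d + 1) → ℕ)
    (hpos : ∀ k ν, 0 < Mseq k ν) (hlim : ∀ ν, Tendsto (fun k => (Mseq k ν : ℝ)) atTop atTop) :
    Tendsto (fun k => haveI : ∀ ν, NeZero (Mseq k ν) := fun ν => ⟨(hpos k ν).ne'⟩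
      (Fintype.card (Tor (Mseq k)) : ℝ)⁻¹ * Real.log (gaussNorm (Matrix.of fun b b' => effLaplacianLim L (Mseq k) a m2 b b'))) atTop
      (𝓝 (1 / 2 * Real.log (2 * Real.pi) - 1 / 2 * bzMean (fun p : Fin (d + 1) → ℝ => Real.log (effSymLim a L m2 p)) d)) := by
  have hL1 : (1 : ℝ) < L := by exact_mod_cast (show 1 < L by omega)
  have h := (tendsto_sum_symbol_sOf_div_card_of_continuousAt (fun p : Fin (d + 1) → ℝ => Real.log (effSymLim a L m2 p))
    (fun p hp => continuousAt_log_effSymLim ha hL1 hm hp) Mseq hpos hlim)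
  refine ((tendsto_const_nhds (x := 1 / 2 * Real.log (2 * Real.pi))).sub (h.const_mul (1 / 2))).congr fun k => ?_
  haveI : ∀ ν, NeZero (Mseq k ν) := fun ν => ⟨(hpos k ν).ne'⟩
  have hcard : (Fintype.card (Tor (Mseq k)) : ℝ) ≠ 0 := by exact_mod_cast Fintype.card_ne_zero
  rw [log_gaussNorm_effLaplacianLim L (Mseq k) hLodd hL ha hm, mul_sub]
  congr 1
  · field_simp
  · ring

/-- ★★★ **KING's (3.93) PER SITE WITH BOTH LIMITS TAKEN**: `|bzMean(ln Δ^{(K)}) − bzMean(ln Δ^{(∞)})| ≤ C′·L^{−2K}` for every `K ≥ 1` (`C′ = (a_∞⁻¹+m⁻²)·C_Δ(a)`; part Ε-o's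
volume-uniform rate passed to infinite volume along the cubes). [cite: King1986, (3.93) p.669, Thm 3.4 (3.9) p.656] -/
theorem abs_bzMean_log_DeltaEff_sub_lim_le (hLodd : Odd L) (hL : 2 ≤ L) {a m2 : ℝ} (ha : 0 < a) (hm : 0 < m2) {K : ℕ} (hK : 1 ≤ K) :
    |bzMean (fun p : Fin (d + 1) → ℝ => Real.log (DeltaEff (aK a L K) (L ^ K) m2 p)) d - bzMean (fun p : Fin (d + 1) → ℝ => Real.log (effSymLim a L m2 p)) d|
      ≤ ((aInf a L)⁻¹ + m2⁻¹) * (8 / 3 * (a ^ 2 * (a⁻¹ + Real.pi ^ 2 / 48 + 1 / 3)) + 4 / 3 * a) * ((L : ℝ) ^ (2 * K))⁻¹ := by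
  haveI : NeZero L := ⟨by omega⟩
  have hL1 : (1 : ℝ) < L := by exact_mod_cast (show 1 < L by omega)
  haveI : NeZero (L ^ K) := ⟨pow_ne_zero _ (NeZero.ne L)⟩
  set Mseq : ℕ → Fin (d + 1) → ℕ := fun k _ => k + 1 with hMseq
  have hpos : ∀ k ν, 0 < Mseq k ν := fun k ν => Nat.succ_pos k
  have hlim : ∀ ν : Fin (d + 1), Tendsto (fun k => (Mseq k ν : ℝ)) atTop atTop := fun ν => by
    simp only [hMseq]
    exact tendsto_natCast_atTop_atTop.comp (tendsto_add_atTop_nat 1)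
  have t1 := tendsto_log_det_effLaplacian_div_card (L ^ K) (Nat.one_le_pow _ _ (by omega)) (aK_pos ha hL1 hK) hm Mseq hpos hlim
  have t2 := tendsto_log_det_effLaplacianLim_div_card L hLodd hL ha hm Mseq hpos hlim
  refine le_of_tendsto' ((t1.sub t2).abs) fun k => ?_
  haveI : ∀ ν, NeZero (Mseq k ν) := fun ν => ⟨(hpos k ν).ne'⟩
  exact abs_log_det_div_card_sub_lim_le L (Mseq k) hLodd hL ha hm hK

/-- ★★★ **THE DOUBLE LIMIT**: `bzMean(ln Δ^{(K)}) → bzMean(ln Δ^{(∞)})` as `K → ∞` — the infinite-volume block-field normalisation density converges to the infinite-volume continuum one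
(part Ε-t's `f_∞` identified). [cite: King1986, Thm 3.4 (3.9) p.656, (3.93) p.669] -/
theorem tendsto_bzMean_log_DeltaEff (hLodd : Odd L) (hL : 2 ≤ L) {a m2 : ℝ} (ha : 0 < a) (hm : 0 < m2) :
    Tendsto (fun K : ℕ => bzMean (fun p : Fin (d + 1) → ℝ => Real.log (DeltaEff (aK a L K) (L ^ K) m2 p)) d) atTop
      (𝓝 (bzMean (fun p : Fin (d + 1) → ℝ => Real.log (effSymLim a L m2 p)) d)) := by
  have hL1 : (1 : ℝ) < L := by exact_mod_cast (show 1 < L by omega)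
  set C : ℝ := ((aInf a L)⁻¹ + m2⁻¹) * (8 / 3 * (a ^ 2 * (a⁻¹ + Real.pi ^ 2 / 48 + 1 / 3)) + 4 / 3 * a) with hC
  have h0 : Tendsto (fun K : ℕ => ((L : ℝ) ^ (2 * K))⁻¹) atTop (𝓝 0) := by
    have h : Tendsto (fun K : ℕ => (((L : ℝ) ^ 2)⁻¹) ^ K) atTop (𝓝 0) :=
      tendsto_pow_atTop_nhds_zero_of_lt_one (by positivity) (inv_lt_one_of_one_lt₀ (by nlinarith))
    refine h.congr fun K => ?_
    rw [inv_pow, pow_mul]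
  have hr : Tendsto (fun K : ℕ => C * ((L : ℝ) ^ (2 * K))⁻¹) atTop (𝓝 0) := by
    have := h0.const_mul C
    rwa [mul_zero] at this
  refine tendsto_sub_nhds_zero_iff.mp (squeeze_zero_norm' ?_ hr)
  filter_upwards [eventually_ge_atTop 1] with K hK
  rw [Real.norm_eq_abs]
  exact abs_bzMean_log_DeltaEff_sub_lim_le L hLodd hL ha hm hK

/-- part Ε-t's limit `f_∞` IS `bzMean(ln Δ^{(∞)})` (uniqueness of limits). [cite: King1986, Thm 3.4 (3.9) p.656] -/
theorem eq_bzMean_lim_of_tendsto (hLodd : Odd L) (hL : 2 ≤ L) {a m2 : ℝ} (ha : 0 < a) (hm : 0 < m2) {f : ℝ}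
    (hf : Tendsto (fun K : ℕ => bzMean (fun p : Fin (d + 1) → ℝ => Real.log (DeltaEff (aK a L K) (L ^ K) m2 p)) d) atTop (𝓝 f)) :
    f = bzMean (fun p : Fin (d + 1) → ℝ => Real.log (effSymLim a L m2 p)) d :=
  tendsto_nhds_unique hf (tendsto_bzMean_log_DeltaEff L hLodd hL ha hm)

end Limits

end Summit.QuantumFields.YangMills.BalabanUVNodes.N15KingModelRung.TorusSpectral

end
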